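import Summits.QuantumFields.YangMills.Theorems.SwapVirialDeficitSectorLaplaceEndGaussSlabMatch
import Summits.QuantumFields.YangMills.Theorems.SwapVirialDeficitBlowUpGnomonicLeaderGroupDist
import Summits.QuantumFields.YangMills.Theorems.SwapVirialDeficitGnomonicTaylorChordLine
import HarnessLib

/-!
# N2a step (iv)′ — THE SLAB-HUB ONE-LOOP WEIGHT AGAINST THE REFERENCE `D(p′)` WITH THE LEADER DISPLACEMENT MEASURED IN THE GROUP (three-step matching)
# (stub `stub_end_gaussCore` of skeleton ➎; memo11a ∕ w3 memo-N2a(iv): at the gnomonic ends the letter distance to the base point is large while the group distance is small,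
# so g48's ✓`sqrt_det_inv_slabHub_le_ref` (joint LETTER law) is replaced by: (1) joint law for hub angle + follower displacement `η⋆ → η₀` (small), (2) w2's GROUP law (K7g)
# `η₀ → gnoBase(x₀,y₀)` at the reference hub with the hD of ✓`leaderGroupDist_le`; free-hands support of ⟨stmt-QuantumFields-24197⟩ `SwapVirialDeficit.SwapGluedStiffness`)

* `refHub_coercive_of_groupNear` — `(μ_F − 3219264L⁴D)‖v‖² ≤ ⟪AF η₀ v, v⟫` at a slab leader point `η₀ = ((x,y),(z,0))` whose leader tuple is within group distance `D ≤ 1` of its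
  base point's (K7g form law + g48 ✓`gnoFolHessian_coercive_base`);
* ★★★ `sqrt_det_inv_slabHub_le_ref_group` — for the slab family `A` (hub `hubAt δ 1`, ambient identity) and the reference `AF` (hub `hubAt 0 1`, (I1)):
  `ofReal((√det A (η₀ + gnoFolEmb ys))⁻¹) ≤ ofReal(exp(K₁ + K₂)) · ofReal((√det AF(gnoBase (x 0) (y 0)))⁻¹)`, `K₁ = 3|Fol|·Δ₁/(μ_F/2)`, `Δ₁ = (122689728|δ| + 44712000‖gnoFolEmb ys‖)L⁴`,
  `K₂ = 3|Fol|·3219264L⁴D/μ_F`, under `3219264L⁴D ≤ μ_F/4`, `Δ₁ ≤ μ_F/4`, `0 < D ≤ 1`, `D ≥` the three compressed letter sizes (✓`leaderGroupDist_le`).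
  INPUT of memo11c (2)/(iv): with `‖ys‖² ≤ F̂(η₀)/μ_F` (✓`endGauss_N2_near_raw`) and NEAR₁ := compressed letters `≤ r`, both smallness conditions are t-uniform.

HONEST LABEL: composition of landed Lipschitz laws; N2a (v), the glue and the plug of `stub_end_gaussCore`, and `stub_core_tip` are OPEN ⟹ ⟨24197⟩ ∕ ⟨24194⟩ OPEN; own crux ⟨22884⟩
OPEN (blocked-on ⟨19935⟩); the Yang–Mills mass gap is NOT proved; no summit is proved by a line.  THEOREMS ONLY (0 `def`, 0 `sorry`), standard axioms.
Width seat ym-line-sfw-p2-w3 g67 (cell ym-idea-1, free hands), `--supports stmt-QuantumFields-24197`.  References: [folklore]; [cite: Luscher1983, §2].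
-/

set_option autoImplicit false
set_option synthInstance.maxSize 1024

noncomputable section

open MeasureTheory Quaternion Set Module
open scoped Quaternion BigOperators ENNReal InnerProductSpace
open Literature.MathematicalPhysics.QuantumLattice
open Literature.MathematicalPhysics.QuantumFieldTheory hiding SU2

namespace Summit.QuantumFields.YangMills.Theorems.SwapVirialDeficit.SectorLaplace

open Summit.QuantumFields.YangMills.Theorems.FemtoTransferGap
open Summit.QuantumFields.YangMills.Theorems.FemtoTransferGap.TT
open Summit.QuantumFields.YangMills.Theorems.VirialFluxGap.RingDeficit
open Summit.QuantumFields.YangMills.Theorems.SwapVirialDeficit.SwapRing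
open Summit.QuantumFields.YangMills.Theorems.SwapVirialDeficit.BlowUpRing

variable {L : ℕ} [NeZero L]

omit [NeZero L] in
/-- The group-distance bound from ✓`leaderGroupDist_le`, oriented as K7g's `hD` between the base point `gnoBase (x 0) (y 0)` and `η₀ = ((x,y),(z,0))` at the hub `hubAt 0 1`.
[folklore] -/
theorem leaderGroupDist_base_le (ε : GnoSign L) (x y z : Fin 3 → ℝ) {D : ℝ}
    (hDge : Real.sqrt (2 * ((x 1) ^ 2 + (x 2) ^ 2) / (1 + ((x 0) ^ 2 + (x 1) ^ 2 + (x 2) ^ 2))) +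
        Real.sqrt (2 * ((z 0) ^ 2 + (z 1) ^ 2 + (z 2) ^ 2) / (1 + ((z 0) ^ 2 + (z 1) ^ 2 + (z 2) ^ 2))) +
        Real.sqrt (2 * ((y 1) ^ 2 + (y 2) ^ 2) / (1 + ((y 0) ^ 2 + (y 1) ^ 2 + (y 2) ^ 2))) ≤ D) (μ : Fin 4) :
    ‖su2Quat ((blowUpPoint (L := L) 1 (gnomonicPoint (hubAt 0 1) ε (gnoBase (x 0) (y 0)))).1 μ) -
        su2Quat ((blowUpPoint (L := L) 1 (gnomonicPoint (hubAt 0 1) ε (((x, y), (z, (0 : Fol L → Fin 3 → ℝ))) : GnoCoord L))).1 μ)‖ ≤ D :=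
  (leaderGroupDist_le (L := L) 0 ε x y z 0 0 μ).trans hDge

/-- ★ **COERCIVITY OF THE REFERENCE FAMILY AT A SLAB LEADER POINT, via the GROUP law**: `(μ_F − 3219264L⁴D)‖v‖² ≤ ⟪AF ((x,y),(z,0)) v, v⟫`. [cite: Luscher1983, §2] -/
theorem refHub_coercive_of_groupNear {ε : GnoSign L} (hε : GoodSign ε) {AF : GnoCoord L → GnoFol L →ₗ[ℝ] GnoFol L}
    (hFyy : ∀ η (y : GnoFol L), ⟪AF η y, y⟫_ℝ =
      iteratedFDeriv ℝ 2 (fun y' : GnoFol L => gnoDeficit (fun _ => false) (fun _ => 1) (hubAt 0 1) ε (η + gnoFolEmb y')) 0 (fun _ => y))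
    (x y z : Fin 3 → ℝ) {D : ℝ} (hD0 : 0 < D) (hD1 : D ≤ 1)
    (hDge : Real.sqrt (2 * ((x 1) ^ 2 + (x 2) ^ 2) / (1 + ((x 0) ^ 2 + (x 1) ^ 2 + (x 2) ^ 2))) +
        Real.sqrt (2 * ((z 0) ^ 2 + (z 1) ^ 2 + (z 2) ^ 2) / (1 + ((z 0) ^ 2 + (z 1) ^ 2 + (z 2) ^ 2))) +
        Real.sqrt (2 * ((y 1) ^ 2 + (y 2) ^ 2) / (1 + ((y 0) ^ 2 + (y 1) ^ 2 + (y 2) ^ 2))) ≤ D) (v : GnoFol L) :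
    ((2304 * (L : ℝ) ^ 6 * (Fintype.card (Fol L) : ℝ))⁻¹ - 3219264 * (L : ℝ) ^ 4 * D) * ‖v‖ ^ 2 ≤
      ⟪AF (((x, y), (z, (0 : Fol L → Fin 3 → ℝ))) : GnoCoord L) v, v⟫_ℝ := by
  have hray := folRay_of_fibreForm (L := L) (hubAt_one_ne_zero 0) ε hFyy
  have hcoer := gnoFolHessian_coercive_base (hubAt_one_ne_zero 0) ε hε.1 hε.2 (x 0) (y 0) hray v
  have hdiff := abs_gnoFolHessianForm_sub_le_leaders (L := L) (fun _ => false) (fun _ => (1 : SU2)) (a := hubAt 0 1) (a' := hubAt 0 1) ε hε.2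
    (η := (((x, y), (z, (0 : Fol L → Fin 3 → ℝ))) : GnoCoord L)) (η' := gnoBase (x 0) (y 0)) rfl hFyy hFyy hD0 hD1 (leaderGroupDist_base_le ε x y z hDge) v
  have h2 := (abs_le.1 hdiff).1
  nlinarith [h2, hcoer]

/-- ★★★ **THE SLAB-HUB ONE-LOOP WEIGHT AGAINST `D(p′)`, GROUP VERSION** (three-step matching: joint law for the hub angle and the follower displacement `ys`, K7g for the
leaders).  `η₀ = ((x,y),(z,0))`, `η⋆ = η₀ + gnoFolEmb ys`, reference base point `gnoBase (x 0) (y 0)`. [cite: Breitung1994, Lemma 26 (2.102), p. 30] -/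
theorem sqrt_det_inv_slabHub_le_ref_group {ε : GnoSign L} (hε : GoodSign ε) {AF : GnoCoord L → GnoFol L →ₗ[ℝ] GnoFol L} (hFs : ∀ η, (AF η).IsSymmetric)
    (hFyy : ∀ η (y : GnoFol L), ⟪AF η y, y⟫_ℝ =
      iteratedFDeriv ℝ 2 (fun y' : GnoFol L => gnoDeficit (fun _ => false) (fun _ => 1) (hubAt 0 1) ε (η + gnoFolEmb y')) 0 (fun _ => y))
    (hamb : ∀ η (y : GnoFol L), ⟪AF η y, y⟫_ℝ = iteratedFDeriv ℝ 2 (gnoDeficit (fun _ => false) (fun _ => 1) (hubAt 0 1) ε) η (fun _ => gnoFolEmb y))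
    {δ : ℝ} {A : GnoCoord L → GnoFol L →ₗ[ℝ] GnoFol L} (hAs : ∀ η, (A η).IsSymmetric)
    (hambA : ∀ η (y : GnoFol L), ⟪A η y, y⟫_ℝ = iteratedFDeriv ℝ 2 (gnoDeficit (fun _ => false) (fun _ => 1) (hubAt δ 1) ε) η (fun _ => gnoFolEmb y))
    (x y z : Fin 3 → ℝ) (ys : GnoFol L)
    (hcoerA : ∀ v : GnoFol L, (2304 * (L : ℝ) ^ 6 * (Fintype.card (Fol L) : ℝ))⁻¹ / 2 * ‖v‖ ^ 2 ≤
      ⟪A ((((x, y), (z, (0 : Fol L → Fin 3 → ℝ))) : GnoCoord L) + gnoFolEmb ys) v, v⟫_ℝ)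
    {D : ℝ} (hD0 : 0 < D) (hD1 : D ≤ 1)
    (hDge : Real.sqrt (2 * ((x 1) ^ 2 + (x 2) ^ 2) / (1 + ((x 0) ^ 2 + (x 1) ^ 2 + (x 2) ^ 2))) +
        Real.sqrt (2 * ((z 0) ^ 2 + (z 1) ^ 2 + (z 2) ^ 2) / (1 + ((z 0) ^ 2 + (z 1) ^ 2 + (z 2) ^ 2))) +
        Real.sqrt (2 * ((y 1) ^ 2 + (y 2) ^ 2) / (1 + ((y 0) ^ 2 + (y 1) ^ 2 + (y 2) ^ 2))) ≤ D)
    (hDsmall : 3219264 * (L : ℝ) ^ 4 * D ≤ (2304 * (L : ℝ) ^ 6 * (Fintype.card (Fol L) : ℝ))⁻¹ / 4)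
    (hnear : (122689728 * |δ| + 44712000 * ‖(gnoFolEmb ys : GnoCoord L)‖) * (L : ℝ) ^ 4 ≤ (2304 * (L : ℝ) ^ 6 * (Fintype.card (Fol L) : ℝ))⁻¹ / 4) :
    ENNReal.ofReal ((Real.sqrt (LinearMap.det (A ((((x, y), (z, (0 : Fol L → Fin 3 → ℝ))) : GnoCoord L) + gnoFolEmb ys))))⁻¹) ≤
      ENNReal.ofReal (Real.exp ((3 * (Fintype.card (Fol L) : ℝ)) * ((122689728 * |δ| + 44712000 * ‖(gnoFolEmb ys : GnoCoord L)‖) * (L : ℝ) ^ 4) /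
            ((2304 * (L : ℝ) ^ 6 * (Fintype.card (Fol L) : ℝ))⁻¹ / 2) +
          (3 * (Fintype.card (Fol L) : ℝ)) * (3219264 * (L : ℝ) ^ 4 * D) / (2304 * (L : ℝ) ^ 6 * (Fintype.card (Fol L) : ℝ))⁻¹)) *
        ENNReal.ofReal ((Real.sqrt (LinearMap.det (AF (gnoBase (x 0) (y 0)))))⁻¹) := by
  set μ : ℝ := (2304 * (L : ℝ) ^ 6 * (Fintype.card (Fol L) : ℝ))⁻¹ with hμ
  have hμ0 : 0 < μ := (folMu_pos_le (L := L)).1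
  have hL : (0 : ℝ) < L := by exact_mod_cast NeZero.pos L
  set η₀ : GnoCoord L := (((x, y), (z, (0 : Fol L → Fin 3 → ℝ))) : GnoCoord L) with hη₀
  set η₁ : GnoCoord L := η₀ + gnoFolEmb ys with hη₁
  set Δ₁ : ℝ := (122689728 * |δ| + 44712000 * ‖(gnoFolEmb ys : GnoCoord L)‖) * (L : ℝ) ^ 4 with hΔ₁
  have hΔ₁0 : 0 ≤ Δ₁ := by positivity
  have hray := folRay_of_fibreForm (L := L) (hubAt_one_ne_zero 0) ε hFyy
  -- (a) base: det and coercivity of `AF` at `gnoBase`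
  have hdetB : μ ^ finrank ℝ (GnoFol L) ≤ LinearMap.det (AF (gnoBase (x 0) (y 0))) := det_gnoFolHessian_base_ge (hubAt_one_ne_zero 0) ε hε.1 hε.2 (x 0) (y 0) hFs hray
  have hposB : 0 < LinearMap.det (AF (gnoBase (x 0) (y 0))) := lt_of_lt_of_le (by positivity) hdetB
  have hcoerB : ∀ v : GnoFol L, μ * ‖v‖ ^ 2 ≤ ⟪AF (gnoBase (x 0) (y 0)) v, v⟫_ℝ := gnoFolHessian_coercive_base (hubAt_one_ne_zero 0) ε hε.1 hε.2 (x 0) (y 0) hray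
  -- (b) reference family at `η₀`: coercive with `μ/2` by the group law
  have hcoer0 : ∀ v : GnoFol L, (μ / 2) * ‖v‖ ^ 2 ≤ ⟪AF η₀ v, v⟫_ℝ := fun v => by
    have h := refHub_coercive_of_groupNear (L := L) hε hFyy x y z hD0 hD1 hDge v
    rw [← hη₀] at h
    nlinarith [h, hDsmall, sq_nonneg ‖v‖]
  have hdet0 : (μ / 2) ^ finrank ℝ (GnoFol L) ≤ LinearMap.det (AF η₀) := det_ge_pow_of_coercive (hFs η₀) (by positivity) hcoer0
  have hpos0 : 0 < LinearMap.det (AF η₀) := lt_of_lt_of_le (by positivity) hdet0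
  -- (c) K7g det law: `AF η₀` vs `AF base`
  have hlog2 := abs_log_det_gnoFolHessian_sub_le_leaders (L := L) (fun _ => false) (fun _ => (1 : SU2)) (a := hubAt 0 1) (a' := hubAt 0 1) ε hε.2
    (η := η₀) (η' := gnoBase (x 0) (y 0)) (by rw [hη₀]; rfl) hFs hFs hFyy hFyy hD0 hD1 (by rw [hη₀]; exact leaderGroupDist_base_le ε x y z hDge) hμ0 hcoerB
    (by nlinarith [hDsmall, hμ0])
  -- (d) joint law: `A η₁` (angle θ(δ)) vs `AF η₀` (angle θ(0)), displacement `gnoFolEmb ys`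
  have hdet1 : (μ / 2) ^ finrank ℝ (GnoFol L) ≤ LinearMap.det (A η₁) := det_ge_pow_of_coercive (hAs η₁) (by positivity) (by rw [hη₁, hη₀]; exact hcoerA)
  have hpos1 : 0 < LinearMap.det (A η₁) := lt_of_lt_of_le (by positivity) hdet1
  have eθ : gnoDeficit (fun _ => false) (fun _ => (1 : SU2)) (hubAt δ 1) ε = gnoDeficit (fun _ => false) (fun _ => 1) (angUnit (Real.pi / 2 - Real.arctan δ)) ε :=
    funext fun η => gnoDeficit_hubAt_eq_angUnit _ _ δ ε η
  have eθ' : gnoDeficit (fun _ => false) (fun _ => (1 : SU2)) (hubAt 0 1) ε = gnoDeficit (fun _ => false) (fun _ => 1) (angUnit (Real.pi / 2 - Real.arctan 0)) ε :=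
    funext fun η => gnoDeficit_hubAt_eq_angUnit _ _ 0 ε η
  have hambθ : ∀ η (y : GnoFol L), ⟪A η y, y⟫_ℝ = iteratedFDeriv ℝ 2 (gnoDeficit (fun _ => false) (fun _ => 1) (angUnit (Real.pi / 2 - Real.arctan δ)) ε) η
      (fun _ => gnoFolEmb y) := fun η y => by rw [← eθ]; exact hambA η y
  have hambθ' : ∀ η (y : GnoFol L), ⟪AF η y, y⟫_ℝ = iteratedFDeriv ℝ 2 (gnoDeficit (fun _ => false) (fun _ => 1) (angUnit (Real.pi / 2 - Real.arctan 0)) ε) η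
      (fun _ => gnoFolEmb y) := fun η y => by rw [← eθ']; exact hamb η y
  have hθθ : |(Real.pi / 2 - Real.arctan δ) - (Real.pi / 2 - Real.arctan 0)| ≤ |δ| := (abs_hubAngle_sub_le δ 0).trans (by rw [sub_zero])
  have hdist : ‖η₁ - η₀‖ = ‖(gnoFolEmb ys : GnoCoord L)‖ := by rw [hη₁, add_sub_cancel_left]
  have hΔ' : (122689728 * |(Real.pi / 2 - Real.arctan δ) - (Real.pi / 2 - Real.arctan 0)| + 44712000 * ‖η₁ - η₀‖) * (L : ℝ) ^ 4 ≤ Δ₁ := by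
    rw [hΔ₁, hdist]; gcongr
  have hlog1 := abs_log_det_gnoFolHessian_sub_le_joint (fun _ => false) (fun _ => (1 : SU2)) (sin_hubAngle_pos δ).le (sin_hubAngle_pos 0).le ε hAs hFs
    hambθ hambθ' (η := η₁) (η' := η₀) (by positivity : 0 < μ / 2) hcoer0 (hΔ'.trans (by linarith))
  -- (e) combine the two logs
  set K₁ : ℝ := (3 * (Fintype.card (Fol L) : ℝ)) * Δ₁ / (μ / 2) with hK₁
  set K₂ : ℝ := (3 * (Fintype.card (Fol L) : ℝ)) * (3219264 * (L : ℝ) ^ 4 * D) / μ with hK₂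
  have hc0 : (0 : ℝ) ≤ 3 * (Fintype.card (Fol L) : ℝ) := by positivity
  have hlog1' : |Real.log (LinearMap.det (A η₁)) - Real.log (LinearMap.det (AF η₀))| ≤ 2 * K₁ := by
    refine hlog1.trans ?_
    rw [hK₁, show 2 * (3 * (Fintype.card (Fol L) : ℝ) * Δ₁ / (μ / 2)) = 2 * (3 * (Fintype.card (Fol L) : ℝ)) * Δ₁ / (μ / 2) by ring]
    exact div_le_div_of_nonneg_right (mul_le_mul_of_nonneg_left hΔ' (by positivity)) (by positivity)
  have hlog2' : |Real.log (LinearMap.det (AF η₀)) - Real.log (LinearMap.det (AF (gnoBase (x 0) (y 0))))| ≤ 2 * K₂ := by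
    refine hlog2.trans (le_of_eq ?_); rw [hK₂]; ring
  have hkey : (Real.sqrt (LinearMap.det (A η₁)))⁻¹ ≤ Real.exp (K₁ + K₂) * (Real.sqrt (LinearMap.det (AF (gnoBase (x 0) (y 0)))))⁻¹ := by
    have e1 : (Real.sqrt (LinearMap.det (A η₁)))⁻¹ = Real.exp (-(Real.log (LinearMap.det (A η₁)) / 2)) := by
      rw [Real.sqrt_eq_rpow, Real.rpow_def_of_pos hpos1, ← Real.exp_neg]; congr 1; ring
    have e2 : Real.exp (K₁ + K₂) * (Real.sqrt (LinearMap.det (AF (gnoBase (x 0) (y 0)))))⁻¹ =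
        Real.exp (K₁ + K₂ + -(Real.log (LinearMap.det (AF (gnoBase (x 0) (y 0)))) / 2)) := by
      rw [Real.sqrt_eq_rpow, Real.rpow_def_of_pos hposB, ← Real.exp_neg, ← Real.exp_add]; congr 1; ring
    rw [e1, e2, Real.exp_le_exp]
    have a1 := (abs_le.1 hlog1').1
    have a2 := (abs_le.1 hlog2').1
    linarith
  have eK : Real.exp ((3 * (Fintype.card (Fol L) : ℝ)) * ((122689728 * |δ| + 44712000 * ‖(gnoFolEmb ys : GnoCoord L)‖) * (L : ℝ) ^ 4) / (μ / 2) +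
      (3 * (Fintype.card (Fol L) : ℝ)) * (3219264 * (L : ℝ) ^ 4 * D) / μ) = Real.exp (K₁ + K₂) := by rw [hK₁, hK₂]
  rw [eK]
  calc ENNReal.ofReal ((Real.sqrt (LinearMap.det (A η₁)))⁻¹) ≤ ENNReal.ofReal (Real.exp (K₁ + K₂) * (Real.sqrt (LinearMap.det (AF (gnoBase (x 0) (y 0)))))⁻¹) :=
        ENNReal.ofReal_le_ofReal hkey
    _ = _ := ENNReal.ofReal_mul (Real.exp_pos _).le

end Summit.QuantumFields.YangMills.Theorems.SwapVirialDeficit.SectorLaplace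

end
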